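import Summits.KontsevichZagierPeriods.Zeta5Search.WedgeDictionaryQPart
import Summits.KontsevichZagierPeriods.Zeta5Search.WedgeDictionaryForms
import Summits.KontsevichZagierPeriods.Zeta5Search.Certificates.DualSeriesTermBounds
import HarnessLib

/-!
# ζ(5) search — certificates: the forms of the census T1-map ray g8 #1 BY NAME (cell `pub-zeta5`, P1 g11)

HONEST FRAMING: systematic search; no irrationality claim unless certified.

OUR work (Summit side; port of certifier 2's `Certificates/RecordRayForms.lean` from Brown–Zudilin's record ray to the
census's top T1-map class g8 #1). The ray is `a·n`, `a = (18,32,23,30,28,38,43,30)` (census g8/g22 class #1; a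
CONVERGENT vector of [BrownZudilin2022, (3)]), with dual parameters `b = b(a·n) = n·(85; 35,32,30,27,25,22,20)`,
`d = 64n`, partner `b′ = b + e₇`. This file fixes, WITHOUT any conjecture, the objects every later certificate of this
ray refers to:

* `c1Q n = Q(a·n) ∈ ℤ` — the printed leading coefficient (17) (`BrownZudilin2022.QOf`);
* `c1P n = ρ(a·n)·(W(b′)V(b) − W(b)V(b′)) ∈ ℚ` — the wedge-dictionary companion (`rhoOf`, `coeffW`, `coeffV`);
* `c1Form n = ρ(a·n)·(W(b′)·F̃₇(b) − W(b)·F̃₇(b′)) ∈ ℝ` — the `ζ(3)`-free combination of two contiguous very-well-poised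
  series (34) (`vwpDual 7`); the slots as naturals `BC1E e n` (`e` = shift of the seventh slot: `e = 0` is `b`,
  `e = 1` is `b′`) in certifier 2's `natB` format, so that the generic dual-series layer
  (`Certificates/DualSeriesTermBounds`) applies verbatim;

and PROVES, for every `n ≥ 1`, `c1Q_eq_wedge : Q(a·n) = ρ(a·n)·(U(b)W(b′) − U(b′)W(b))` (the Q-part of the wedge
dictionary, tree THEOREM `WedgeDictionary.wedgeDictionary_Q`, its side conditions decided here) and
`c1Form_eq : c1Form n = c1Q n · ζ(5) − c1P n` (`WedgeDictionary.zeta3_elimination`). Nothing here is a rate, a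
denominator, or a statement about `ζ(5)`.
-/

noncomputable section

open Finset

namespace Summit.KontsevichZagierPeriods.Zeta5Search.RayC1

open Summit.KontsevichZagierPeriods.Zeta5Search.DualSeries
open Summit.KontsevichZagierPeriods.Zeta5Search.DualSeriesBounds (natB natB_zero natB_succ inBox_natB)
open Summit.KontsevichZagierPeriods.Zeta5Search.WedgeDictionary
open Literature.NumberTheory.Irrationality.BrownZudilin2022 (bOfA Converges QOf vwpDual convergenceForms)
open Literature.NumberTheory.Transcendental (zetaValue)

/-! ### The objects -/

/-- The census g8 class-#1 vector `a = (18,32,23,30,28,38,43,30)`. -/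
def c1Vec : Fin 8 → ℤ := ![18, 32, 23, 30, 28, 38, 43, 30]

/-- The scaled parameters `a·n`. -/
def aC1 (n : ℕ) : Fin 8 → ℤ := fun i => (n : ℤ) * c1Vec i

/-- The dual slots `β = (35,32,30,27,25,22,20)` (index `j` for `β_{j+1}`; `0` beyond). -/
def βC1 (j : ℕ) : ℕ :=
  if j = 0 then 35 else if j = 1 then 32 else if j = 2 then 30 else if j = 3 then 27
  else if j = 4 then 25 else if j = 5 then 22 else if j = 6 then 20 else 0

/-- The natural slots of `b` (`e = 0`) and of the partner `b′ = b + e₇` (`e = 1`): `B_j = β_{j+1}·n + [j = 6]·e`. -/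
def BC1E (e n : ℕ) : ℕ → ℕ := fun j => βC1 j * n + if j = 6 then e else 0

/-- `b = b(a·n) = n·(85; 35,32,30,27,25,22,20)` as an integer vector. -/
def bC1 (n : ℕ) : ℕ → ℤ := natB (85 * n) (BC1E 0 n)

/-- The partner `b′ = b + e₇`. -/
def bC1' (n : ℕ) : ℕ → ℤ := natB (85 * n) (BC1E 1 n)

/-- `Q_n = Q(a·n)`, Brown–Zudilin's leading coefficient (17) on the ray (an integer). -/
def c1Q (n : ℕ) : ℤ := QOf (aC1 n)

/-- `P_n = ρ(a·n)·(W(b′)V(b) − W(b)V(b′))`, the rational companion of `Q_n` given by the wedge dictionary. -/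
def c1P (n : ℕ) : ℚ :=
  rhoOf (aC1 n) * (coeffW (bC1' n) * coeffV (bC1 n) - coeffW (bC1 n) * coeffV (bC1' n))

/-- The approximating form `L_n = ρ(a·n)·(W(b′)·F̃₇(b) − W(b)·F̃₇(b′))` of the ray. -/
def c1Form (n : ℕ) : ℝ :=
  (rhoOf (aC1 n) : ℝ) *
    ((coeffW (bC1' n) : ℝ) * vwpDual 7 (bC1 n) - (coeffW (bC1 n) : ℝ) * vwpDual 7 (bC1' n))

/-! ### Slot bookkeeping -/

/-- The values of `βC1`. -/
theorem βC1_values : βC1 0 = 35 ∧ βC1 1 = 32 ∧ βC1 2 = 30 ∧ βC1 3 = 27 ∧ βC1 4 = 25 ∧ βC1 5 = 22 ∧ βC1 6 = 20 := by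
  simp [βC1]

/-- Every slot is at most `35`. -/
theorem βC1_le (j : ℕ) : βC1 j ≤ 35 := by
  unfold βC1; split_ifs <;> omega

/-- Every slot `j < 7` is at least `20`. -/
theorem βC1_ge {j : ℕ} (hj : j < 7) : 20 ≤ βC1 j := by
  unfold βC1; split_ifs <;> omega

/-- `Σ_{j<7} β_{j+1} = 191`. -/
theorem sum_βC1 : ∑ j ∈ range 7, βC1 j = 191 := by
  simp [sum_range_succ, βC1]

/-- `bC1 n 0 = 85n`. -/
theorem bC1_zero (n : ℕ) : bC1 n 0 = 85 * n := by simp [bC1, natB]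

/-- The slots of `bC1 n`: `bC1 n (j+1) = β_{j+1}·n` for `j < 7`. -/
theorem bC1_succ (n : ℕ) {j : ℕ} (hj : j ∈ range 7) : bC1 n (j + 1) = (βC1 j * n : ℕ) := by
  have hj' := mem_range.1 hj
  simp [bC1, natB_succ _ _ hj, BC1E]

/-- `b(a·n) = bC1 n`. -/
theorem bOfA_aC1 (n : ℕ) : bOfA (aC1 n) = bC1 n := by
  funext j
  rcases j with _ | _ | _ | _ | _ | _ | _ | _ | k
  all_goals simp [bOfA, aC1, c1Vec, bC1, natB, BC1E, βC1]
  all_goals ring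

/-- `bC1' n = bC1 n + e₇`. -/
theorem bC1'_eq_update (n : ℕ) : bC1' n = Function.update (bC1 n) 7 (bC1 n 7 + 1) := by
  funext j
  by_cases hj : j = 7
  · subst hj
    simp [Function.update, bC1, bC1', natB, BC1E, βC1]
  · rw [Function.update_of_ne hj]
    unfold bC1 bC1' natB BC1E
    have h6 : j - 1 ≠ 6 ∨ j = 0 := by omega
    rcases h6 with h6 | h0
    · simp [h6]
    · subst h0; simp

/-- The box conditions of the natural slots: `B_j ≤ 85n` (`e ≤ 1`, `n ≥ 1`). -/
theorem hle_c1E {e n : ℕ} (he : e ≤ 1) (hn : 1 ≤ n) : ∀ j ∈ range 7, BC1E e n j ≤ 85 * n := by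
  intro j hj
  unfold BC1E
  have := βC1_le j
  split_ifs <;> nlinarith

/-- The region conditions `2B_j ≤ 85n + 1` (`e ≤ 1`, `n ≥ 1`). -/
theorem hreg_c1E {e n : ℕ} (he : e ≤ 1) (hn : 1 ≤ n) : ∀ j ∈ range 7, 2 * BC1E e n j ≤ 85 * n + 1 := by
  intro j hj
  unfold BC1E
  have := βC1_le j
  split_ifs <;> nlinarith

/-- The summability condition `Σ_j B_j ≤ 3·85n + 1` (`e ≤ 1`). -/
theorem hsum_c1E {e n : ℕ} (he : e ≤ 1) : ∑ j ∈ range 7, BC1E e n j ≤ 3 * (85 * n) + 1 := by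
  have h : ∑ j ∈ range 7, BC1E e n j = 191 * n + e := by
    simp [sum_range_succ, BC1E, βC1]; ring
  rw [h]; omega

/-! ### Side conditions on the ray -/

/-- The parameters `a·n` converge for every `n` (all seventeen forms (3) are non-negative multiples of `n`). -/
theorem converges_aC1 (n : ℕ) : Converges (aC1 n) := by
  intro x hx
  simp only [convergenceForms, aC1, c1Vec, List.mem_cons, List.not_mem_nil, or_false,
    Matrix.cons_val_zero, Matrix.cons_val_one, Matrix.cons_val] at hx
  omega

/-- The region of the wedge dictionary: `0 ≤ b_i` and `2b_i ≤ b₀ + 1` for `i = 1,…,7`. -/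
theorem region_aC1 (n : ℕ) : ∀ i ∈ Icc 1 7, 0 ≤ bOfA (aC1 n) i ∧ 2 * bOfA (aC1 n) i ≤ bOfA (aC1 n) 0 + 1 := by
  intro i hi
  obtain ⟨j, rfl⟩ : ∃ j, i = j + 1 := ⟨i - 1, by have := (mem_Icc.1 hi).1; omega⟩
  have hj : j ∈ range 7 := by have := (mem_Icc.1 hi).2; exact mem_range.2 (by omega)
  rw [bOfA_aC1, bC1_zero, bC1_succ n hj]
  have := βC1_le j
  constructor
  · positivity
  · push_cast; nlinarith [(Nat.cast_nonneg n : (0 : ℤ) ≤ n), (by exact_mod_cast this : (βC1 j : ℤ) ≤ 35)]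

/-- `d(b(a·n)) = 64n`. -/
theorem dOf_aC1 (n : ℕ) : dOf (bOfA (aC1 n)) = 64 * n := by
  rw [dOf_bOfA]
  simp [aC1, c1Vec]
  ring

/-- The box of `DualSeries` holds on the ray. -/
theorem inBox_bC1 (n : ℕ) : InBox (bC1 n) := by
  refine ⟨by rw [bC1_zero]; positivity, fun j hj => ?_⟩
  rw [bC1_zero, bC1_succ n hj]
  have := βC1_le j
  constructor
  · positivity
  · push_cast; nlinarith [(Nat.cast_nonneg n : (0 : ℤ) ≤ n), (by exact_mod_cast this : (βC1 j : ℤ) ≤ 35)]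

/-- The partner `j = 7` is admissible for `n ≥ 1`: `2(b₇ + 1) ≤ b₀ + 1`. -/
theorem partner_aC1 {n : ℕ} (hn : 1 ≤ n) : 2 * (bOfA (aC1 n) 7 + 1) ≤ bOfA (aC1 n) 0 + 1 := by
  rw [bOfA_aC1, bC1_zero, bC1_succ n (by simp)]
  simp only [βC1]
  push_cast
  have : (1 : ℤ) ≤ n := by exact_mod_cast hn
  nlinarith

/-! ### The two identities -/

/-- **Q-part of the wedge dictionary on the ray**: for `n ≥ 1`,
`Q(a·n) = ρ(a·n)·(U(b)W(b′) − U(b′)W(b))` with `b = bC1 n`, `b′ = b + e₇`. -/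
theorem c1Q_eq_wedge {n : ℕ} (hn : 1 ≤ n) :
    (c1Q n : ℚ) = rhoOf (aC1 n) *
      (coeffU (bC1 n) * coeffW (bC1' n) - coeffU (bC1' n) * coeffW (bC1 n)) := by
  have h := wedgeDictionary_Q (aC1 n) 7 (by simp) (converges_aC1 n) (region_aC1 n)
    (by rw [dOf_aC1]; positivity) (partner_aC1 hn)
  rw [bC1'_eq_update]
  simpa only [c1Q, bOfA_aC1] using h

/-- **The ray's forms are `Q(a·n)ζ(5) − P_n`**: for `n ≥ 1`,
`ρ(a·n)·(W(b′)F̃₇(b) − W(b)F̃₇(b′)) = Q(a·n)·ζ(5) − P_n` (ζ(3)-elimination + the Q-part of the dictionary). -/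
theorem c1Form_eq {n : ℕ} (hn : 1 ≤ n) :
    c1Form n = (c1Q n : ℝ) * zetaValue 5 - (c1P n : ℝ) := by
  have hd : 0 ≤ dOf (bC1 n) := by rw [← bOfA_aC1, dOf_aC1]; positivity
  have hle : bC1 n 7 ≤ bC1 n 0 := by
    rw [bC1_zero, bC1_succ n (by simp)]; simp only [βC1]; push_cast; nlinarith
  have h3 := zeta3_elimination (bC1 n) (inBox_bC1 n) hd (j := 7) (by simp) hle
  have hQ : ((c1Q n : ℚ) : ℝ) = ((rhoOf (aC1 n) *
      (coeffU (bC1 n) * coeffW (bC1' n) - coeffU (bC1' n) * coeffW (bC1 n)) : ℚ) : ℝ) := by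
    rw [c1Q_eq_wedge hn]
  unfold c1Form c1P
  rw [show ((c1Q n : ℤ) : ℝ) = ((c1Q n : ℚ) : ℝ) by norm_cast, hQ]
  rw [bC1'_eq_update] at *
  rw [h3]
  push_cast
  ring

end Summit.KontsevichZagierPeriods.Zeta5Search.RayC1
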